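import Mathlib.LinearAlgebra.Matrix.Determinant.Basic
import Mathlib.LinearAlgebra.FiniteDimensional.Basic
import Mathlib.LinearAlgebra.Dimension.Finite
import Mathlib.LinearAlgebra.Dimension.StrongRankCondition
import Mathlib.LinearAlgebra.InvariantBasisNumber
import Mathlib.LinearAlgebra.FreeModule.StrongRankCondition
import Mathlib.LinearAlgebra.Quotient.Basic
import Mathlib.RingTheory.Finiteness.Basic
import Mathlib.RingTheory.Ideal.Quotient.Operations
import Mathlib.Algebra.Algebra.Basic
import Mathlib.Algebra.MvPolynomial.Degrees
import Mathlib.Algebra.MvPolynomial.Eval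
import Literature.Computability.AlgebraicComplexity.DeterminantalComplexity
import Literature.Computability.AlgebraicComplexity.DeterminantalComplexityProofs
import HarnessLib

/-!
# Determinantal representations over a commutative coefficient algebra

Topic `Literature/Computability/AlgebraicComplexity`, notion `HasAlgDetRepr` (definition request
`defn-HasAlgDetRepr` of route `ValiantsHypothesis/GrenetZeon`).

For a commutative ring `k`, a polynomial `f : MvPolynomial σ k` and `m s : ℕ`, an
*`(m, s)`-representation* of `f` (a two-parameter, "coefficient-algebra" determinantal
representation) consists of

* a commutative `k`-algebra `R`, finite as a `k`-module, with `finrank_k R ≤ s`,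
* a `k`-linear functional `λ : R →ₗ[k] k`, and
* an `m × m` matrix `A` of polynomials over `R` of total degree `≤ 1` (affine linear forms in the
  variables with coefficients in `R`),

such that `f = λ (det A)` *coefficientwise*: `λ (coeff_d (det A)) = coeff_d f` for every exponent
`d`. `HasAlgDetRepr f m s` asserts that such a representation exists.

The slice `s = 1` (`R = k`, `λ = id`) is the ordinary affine determinantal representation
`HasDetRepr f m` of Mignon–Ressayre (2004, §1) / Bürgisser (2000, §2.5), whose least `m` is the
determinantal complexity `dc f` (`hasAlgDetRepr_one_iff`, for `0 < m` over a field). The second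
parameter is the accounting of Hrubeš–Yehudayoff (2011, §2 and Thm. 4.2) for computations over an
extension ring `R ⊇ k` of `k`-dimension `s` (there for circuits and formulas; a commutative
extension of dimension `s` can be simulated over `k` at cost `O(s³)`), applied to the determinant
model, together with a functional reading off one `k`-coordinate of the result — as in Glynn's
formula and the extensor/zeon coding of the permanent, where `per_n` is the top coefficient of an
`n × n` (even diagonal) determinant over `ℂ[z₁,…,zₙ]/(zᵢ²)` (Glynn 2010; Brand–Dell–Husfeldt 2018,
§3), and in Grenet's `(2ⁿ - 1) × (2ⁿ - 1)` determinant over `ℂ` itself (Grenet 2011, Thm. 1).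

## Main definitions and results

* `HasAlgDetRepr f m s` — the definition above (the `∃`-form inlined verbatim by the statements
  of route `GrenetZeon`, so that those statements are `HasAlgDetRepr (perPoly (Fin n) ℂ) m s` by
  `Iff.rfl`).
* `HasAlgDetRepr.mono` — monotone in both parameters (pad `A ⊕ 1`, `HasDetRepr.mono_holds`).
* `HasDetRepr.hasAlgDetRepr` — `HasDetRepr f m → HasAlgDetRepr f m 1` (`R = k`, `λ = id`).
* `HasAlgDetRepr.hasDetRepr` / `hasAlgDetRepr_one_iff` — over a field and for `0 < m`,
  `HasAlgDetRepr f m 1 ↔ HasDetRepr f m` (a one-dimensional `R` is `k` itself and the scalar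
  `λ 1` is absorbed into a row of `A`).
* `HasAlgDetRepr.exists_nondegenerate` — WLOG `(R, λ)` is a (commutative) Frobenius pair: dividing
  `R` by the largest ideal contained in `ker λ` (`functionalKerIdeal λ`) keeps the representation,
  does not increase `finrank`, and makes the trace form `(x, y) ↦ λ (x y)` nondegenerate.
* Junk values, documented as lemmas: `hasAlgDetRepr_zero` (`f = 0` is represented with every
  `(m, s)`, through the zero ring), `hasAlgDetRepr_zero_right_iff` (`s = 0` forces `f = 0`: this
  is where `Module.Finite` matters — without it `finrank = 0` would also admit
  infinite-dimensional `R`), `hasAlgDetRepr_zero_left_iff` (`m = 0` represents exactly the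
  constants, whereas `HasDetRepr (C c) 0 ↔ c = 1`; hence the hypothesis `0 < m` in
  `hasAlgDetRepr_one_iff`).

## References

* T. Mignon, N. Ressayre, *A quadratic bound for the determinant and permanent problem*,
  IMRN 2004, §1 (affine determinantal representations, `dc`) (key `MignonRessayre2004`).
* P. Hrubeš, A. Yehudayoff, *Arithmetic complexity in ring extensions*, Theory of Computing 7
  (2011) 119–129, §2 (`dim_R(R')`), Thm. 4.2 (simulating a dimension-`k` extension costs
  `O(k³)`) (key `HrubesYehudayoff2011`).
* D. G. Glynn, *The permanent of a square matrix*, European J. Combin. 31 (2010) 1887–1891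
  (key `Glynn2010`).
* C. Brand, H. Dell, T. Husfeldt, *Extensor-coding*, STOC 2018, §3 (key `BrandDellHusfeldt2018`).
* B. Grenet, *An upper bound for the permanent versus determinant problem* (2011), Thm. 1
  (key `Grenet2011`).

## Design notes

* Neither Mathlib nor the tree has a notion of determinantal representation with coefficients in
  an algebra (`lean search`: `HasDetRepr`, `IsAffineDetRepr`, `determinantalComplexity` only, all
  with `R = k`); the two-parameter notion is the object of route `GrenetZeon` and is new as a
  definition — its published anchors are the ones cited above.
* The coefficient algebra is quantified as `R : Type u` in the universe of `k` (for `k = ℂ`,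
  `R : Type`), exactly as in the route statements; every finite-dimensional `k`-algebra has a
  copy in that universe, so no generality is lost, and the definition has no free universe
  parameter.
* The binders are written `(_ : CommRing R) (_ : Algebra k R) (_ : Module.Finite k R)` (not
  instance brackets) to match the inlined statements token for token.
* Not here (wanted by the route, left to its `--supports` files): the product decomposition of a
  representation along `R ≅ ∏ Rᵢ` (sum of local contributions), compatibility with the base-point
  translation `transl`, and base change in `k`.
-/

noncomputable section

open MvPolynomial Matrix

namespace Literature.Computability.AlgebraicComplexity

universe u v

section Defs

variable {k : Type u} [CommRing k] {σ : Type v}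

/-- `HasAlgDetRepr f m s`: the polynomial `f` over `k` has an **`(m, s)`-representation** — there
are a commutative `k`-algebra `R`, finite over `k` with `finrank_k R ≤ s`, a `k`-linear functional
`λ : R → k` and an `m × m` matrix `A` of affine linear forms over `R` (entries of total degree
`≤ 1` in `MvPolynomial σ R`) with `λ (coeff_d (det A)) = coeff_d f` for every exponent vector `d`,
i.e. `f = λ (det A)` coefficientwise. For `s = 1` (over a field, `0 < m`) this is exactly an
affine determinantal representation of size `m` in the sense of Mignon–Ressayre 2004, §1
(`hasAlgDetRepr_one_iff`); the dimension `s` of the coefficient algebra is the extension-ring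
parameter `dim_k R` of Hrubeš–Yehudayoff 2011, §2. The algebra `R` is quantified in the universe
of `k`. [cite: MignonRessayre2004, §1] -/
def HasAlgDetRepr (f : MvPolynomial σ k) (m s : ℕ) : Prop :=
  ∃ (R : Type u) (_ : CommRing R) (_ : Algebra k R) (_ : Module.Finite k R),
    Module.finrank k R ≤ s ∧ ∃ (l : R →ₗ[k] k) (A : Matrix (Fin m) (Fin m) (MvPolynomial σ R)),
      (∀ i j, (A i j).totalDegree ≤ 1) ∧
        ∀ d : σ →₀ ℕ, l (MvPolynomial.coeff d A.det) = MvPolynomial.coeff d f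

/-- The largest ideal of a commutative `k`-algebra `R` contained in the kernel of a `k`-linear
functional `λ : R → k`: the elements `r` with `λ (x r) = 0` for all `x`, i.e. the radical of the
trace form `(x, y) ↦ λ (x y)`. Dividing by it makes `(R, λ)` a Frobenius pair
(`HasAlgDetRepr.exists_nondegenerate`). [folklore] -/
def functionalKerIdeal {R : Type*} [CommRing R] [Algebra k R] (l : R →ₗ[k] k) : Ideal R where
  carrier := {r | ∀ x, l (x * r) = 0}
  zero_mem' := fun x => by rw [mul_zero, map_zero]
  add_mem' := fun {a b} ha hb x => by rw [mul_add, map_add, ha x, hb x, add_zero]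
  smul_mem' := fun c {r} hr x => by rw [smul_eq_mul, ← mul_assoc]; exact hr (x * c)

end Defs

section API

variable {k : Type u} [CommRing k] {σ : Type v}

/-- Unfolding lemma: `HasAlgDetRepr f m s` is literally the `∃`-form inlined by the statements of
route `GrenetZeon` (Mignon–Ressayre 2004, §1 for the affine entries). [cite: MignonRessayre2004, §1] -/
theorem hasAlgDetRepr_iff (f : MvPolynomial σ k) (m s : ℕ) :
    HasAlgDetRepr f m s ↔
      ∃ (R : Type u) (_ : CommRing R) (_ : Algebra k R) (_ : Module.Finite k R),
        Module.finrank k R ≤ s ∧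
          ∃ (l : R →ₗ[k] k) (A : Matrix (Fin m) (Fin m) (MvPolynomial σ R)),
            (∀ i j, (A i j).totalDegree ≤ 1) ∧
              ∀ d : σ →₀ ℕ, l (MvPolynomial.coeff d A.det) = MvPolynomial.coeff d f :=
  Iff.rfl

/-- Constructor from explicit data, with the algebra structure supplied by instances (the
definition itself spells the instances as anonymous binders, to match the route statements).
[folklore] -/
theorem HasAlgDetRepr.of_data {f : MvPolynomial σ k} {m s : ℕ} (R : Type u) [CommRing R]
    [Algebra k R] [Module.Finite k R] (hR : Module.finrank k R ≤ s) (l : R →ₗ[k] k)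
    (A : Matrix (Fin m) (Fin m) (MvPolynomial σ R)) (hA : ∀ i j, (A i j).totalDegree ≤ 1)
    (hf : ∀ d : σ →₀ ℕ, l (MvPolynomial.coeff d A.det) = MvPolynomial.coeff d f) :
    HasAlgDetRepr f m s :=
  ⟨R, ‹_›, ‹_›, ‹_›, hR, l, A, hA, hf⟩

/-- Membership in `functionalKerIdeal l`. [folklore] -/
theorem mem_functionalKerIdeal_iff {R : Type*} [CommRing R] [Algebra k R] (l : R →ₗ[k] k)
    (r : R) : r ∈ functionalKerIdeal l ↔ ∀ x, l (x * r) = 0 :=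
  Iff.rfl

/-- `functionalKerIdeal l` is contained in `ker l` (take `x = 1`). [folklore] -/
theorem functionalKerIdeal_le_ker {R : Type*} [CommRing R] [Algebra k R] (l : R →ₗ[k] k) :
    (functionalKerIdeal l).restrictScalars k ≤ LinearMap.ker l := fun r hr => by
  rw [LinearMap.mem_ker]
  simpa only [one_mul] using (hr : ∀ x, l (x * r) = 0) 1

/-- **Monotonicity in both parameters.** An `(m, s)`-representation is an `(m', s')`-representation
for `m ≤ m'`, `s ≤ s'`: pad the matrix with an identity block, `A ⊕ 1` (`HasDetRepr.mono_holds`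
over the coefficient algebra; Mignon–Ressayre 2004, §1), and keep `(R, λ)`.
[cite: MignonRessayre2004, §1] -/
theorem HasAlgDetRepr.mono {f : MvPolynomial σ k} {m m' s s' : ℕ} (h : HasAlgDetRepr f m s)
    (hm : m ≤ m') (hs : s ≤ s') : HasAlgDetRepr f m' s' := by
  obtain ⟨R, _, _, _, hR, l, A, hA, hf⟩ := h
  obtain ⟨A', hA', hdet'⟩ := HasDetRepr.mono_holds (f := A.det) ⟨A, hA, rfl⟩ hm
  exact ⟨R, inferInstance, inferInstance, inferInstance, hR.trans hs, l, A', hA',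
    fun d => by rw [hdet', hf]⟩

/-- An affine determinantal representation over `k` is a `(m, 1)`-representation, with `R = k` and
`λ = id` (Mignon–Ressayre 2004, §1). [cite: MignonRessayre2004, §1] -/
theorem HasDetRepr.hasAlgDetRepr [Nontrivial k] {f : MvPolynomial σ k} {m : ℕ}
    (h : HasDetRepr f m) : HasAlgDetRepr f m 1 := by
  obtain ⟨A, hA, hdet⟩ := h
  exact ⟨k, inferInstance, inferInstance, inferInstance, (Module.finrank_self k).le,
    LinearMap.id, A, hA, fun d => by rw [hdet, LinearMap.id_apply]⟩

/-- The zero polynomial has an `(m, s)`-representation for all `m, s` (including `s = 0`),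
through the zero ring `R = 0`, `λ = 0`. (Junk value of the definition; harmless, as `f = 0` is
the only polynomial so represented with `s = 0`, `hasAlgDetRepr_zero_right_iff`.) [folklore] -/
theorem hasAlgDetRepr_zero [Nontrivial k] (m s : ℕ) :
    HasAlgDetRepr (0 : MvPolynomial σ k) m s :=
  ⟨PUnit.{u + 1}, inferInstance, inferInstance, inferInstance,
    (Module.finrank_zero_of_subsingleton (R := k) (M := PUnit.{u + 1})).le.trans (Nat.zero_le s),
    0, 0, fun i j => by rw [Matrix.zero_apply, totalDegree_zero]; exact Nat.zero_le _,
    fun d => by rw [LinearMap.zero_apply, coeff_zero]⟩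

/-- With `m = 0` the matrix is empty, `det A = 1`, and `λ (det A)` is the constant `λ 1`: so
`HasAlgDetRepr f 0 s` (`1 ≤ s`) holds exactly for the constants `f = C c` — every `c`, through
`R = k`, `λ = c • id` — whereas `HasDetRepr (C c) 0` forces `c = 1`. This is why
`hasAlgDetRepr_one_iff` assumes `0 < m`. [folklore] -/
theorem hasAlgDetRepr_zero_left_iff [Nontrivial k] {f : MvPolynomial σ k} {s : ℕ} (hs : 1 ≤ s) :
    HasAlgDetRepr f 0 s ↔ ∃ c : k, f = C c := by
  classical
  constructor
  · rintro ⟨R, _, _, _, -, l, A, -, hf⟩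
    refine ⟨MvPolynomial.coeff 0 f, MvPolynomial.ext _ _ fun d => ?_⟩
    rw [coeff_C]
    split_ifs with hd
    · rw [← hd]
    · rw [← hf d, Matrix.det_isEmpty, coeff_one, if_neg hd, map_zero]
  · rintro ⟨c, rfl⟩
    refine ⟨k, inferInstance, inferInstance, inferInstance, (Module.finrank_self k).le.trans hs,
      c • LinearMap.id, 1, fun i => i.elim0, fun d => ?_⟩
    rw [Matrix.det_isEmpty, LinearMap.smul_apply, LinearMap.id_apply, coeff_one, coeff_C,
      smul_eq_mul]
    split_ifs <;> simp

end API

section Field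

variable {K : Type u} [Field K] {σ : Type v}

/-- `s = 0` forces `f = 0`: a finite `K`-module of `finrank 0` is the zero ring, so `λ = 0`.
(This is where the finiteness of `R` in the definition matters.) Conversely `f = 0` is
represented through the zero ring (`hasAlgDetRepr_zero`). [folklore] -/
theorem hasAlgDetRepr_zero_right_iff {f : MvPolynomial σ K} {m : ℕ} :
    HasAlgDetRepr f m 0 ↔ f = 0 := by
  refine ⟨?_, fun h => h ▸ hasAlgDetRepr_zero m 0⟩
  rintro ⟨R, _, _, _, hR, l, A, -, hf⟩
  haveI : Subsingleton R := Module.finrank_zero_iff.mp (Nat.le_zero.mp hR)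
  exact MvPolynomial.ext _ _ fun d => by
    rw [← hf d, Subsingleton.elim (MvPolynomial.coeff d A.det) 0, map_zero, coeff_zero]

/-- **From `(m, 1)`-representations to determinantal representations** (`0 < m`, over a field).
If `R` is the zero ring then `f = 0 = det 0`. Otherwise `finrank_K R = 1`, so `algebraMap K R` is
a ring isomorphism with inverse `φ`, and `λ = λ(1) · φ`; pushing `A` forward along `φ`
(`HasDetRepr.map_holds`) gives an affine matrix `A'` over `K` with `f = λ(1) · det A'`, and the
scalar `λ(1)` is absorbed into the first row of `A'` (Mignon–Ressayre 2004, §1).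
[cite: MignonRessayre2004, §1] -/
theorem HasAlgDetRepr.hasDetRepr {f : MvPolynomial σ K} {m : ℕ} (hm : 0 < m)
    (h : HasAlgDetRepr f m 1) : HasDetRepr f m := by
  obtain ⟨R, _, _, _, hR, l, A, hA, hf⟩ := h
  let i₀ : Fin m := ⟨0, hm⟩
  rcases subsingleton_or_nontrivial R with hRs | hRn
  · have hf0 : f = 0 := MvPolynomial.ext _ _ fun d => by
      rw [← hf d, Subsingleton.elim (MvPolynomial.coeff d A.det) 0, map_zero, coeff_zero]
    subst hf0
    haveI : Nonempty (Fin m) := ⟨i₀⟩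
    exact ⟨0, fun i j => by rw [Matrix.zero_apply, totalDegree_zero]; exact Nat.zero_le _,
      Matrix.det_zero⟩
  · have h1 : Module.finrank K R = 1 := le_antisymm hR Module.finrank_pos
    have hsurj : Function.Surjective (algebraMap K R) := fun r => by
      obtain ⟨c, hc⟩ := (finrank_eq_one_iff_of_nonzero' (1 : R) one_ne_zero).mp h1 r
      exact ⟨c, by rw [Algebra.algebraMap_eq_smul_one, hc]⟩
    let e : K ≃+* R := RingEquiv.ofBijective (algebraMap K R) ⟨(algebraMap K R).injective, hsurj⟩
    let φ : R →+* K := e.symm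
    have hφ : ∀ r, algebraMap K R (φ r) = r := e.apply_symm_apply
    have hl : ∀ r, l r = φ r * l 1 := fun r => by
      conv_lhs => rw [← hφ r, Algebra.algebraMap_eq_smul_one, map_smul, smul_eq_mul]
    obtain ⟨A', hA', hdet'⟩ := HasDetRepr.map_holds (f := A.det) ⟨A, hA, rfl⟩ φ
    have hfC : f = C (l 1) * A'.det := MvPolynomial.ext _ _ fun d => by
      rw [coeff_C_mul, ← hf d, hl, hdet', coeff_map, mul_comm]
    refine ⟨A'.updateRow i₀ ((C (l 1) : MvPolynomial σ K) • A' i₀), fun i j => ?_, ?_⟩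
    · rw [Matrix.updateRow_apply]
      split_ifs with hi
      · rw [Pi.smul_apply, smul_eq_mul]
        refine (totalDegree_mul _ _).trans ?_
        rw [totalDegree_C, zero_add]
        exact hA' i₀ j
      · exact hA' i j
    · rw [Matrix.det_updateRow_smul, Matrix.updateRow_eq_self, hfC]

/-- **`s = 1` is ordinary determinantal complexity**: for `0 < m`, over a field,
`HasAlgDetRepr f m 1 ↔ HasDetRepr f m` (Mignon–Ressayre 2004, §1). For `m = 0` the left side
holds for every constant and the right side only for `f = 1` (`hasAlgDetRepr_zero_left_iff`).
[cite: MignonRessayre2004, §1] -/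
theorem hasAlgDetRepr_one_iff {f : MvPolynomial σ K} {m : ℕ} (hm : 0 < m) :
    HasAlgDetRepr f m 1 ↔ HasDetRepr f m :=
  ⟨HasAlgDetRepr.hasDetRepr hm, HasDetRepr.hasAlgDetRepr⟩

/-- `dc f ≤ m` whenever `f` has an `(m, 1)`-representation with `0 < m` (Mignon–Ressayre 2004,
§1). [cite: MignonRessayre2004, §1] -/
theorem HasAlgDetRepr.determinantalComplexity_le {f : MvPolynomial σ K} {m : ℕ} (hm : 0 < m)
    (h : HasAlgDetRepr f m 1) : determinantalComplexity f ≤ m :=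
  determinantalComplexity_le_of_hasDetRepr (h.hasDetRepr hm)

/-- **WLOG `(R, λ)` is a Frobenius pair.** Every `(m, s)`-representation of `f` can be replaced by
one in which the trace form `(x, y) ↦ λ (x y)` of the coefficient algebra is nondegenerate
(`∀ r, (∀ x, λ (x r) = 0) → r = 0`), with the same `m` and no larger `finrank`: divide `R` by the
largest ideal `I` contained in `ker λ` (`functionalKerIdeal λ`), push `A` forward along
`R → R ⧸ I` (`HasDetRepr.map_holds`) and let `λ` descend to the quotient. [folklore] -/
theorem HasAlgDetRepr.exists_nondegenerate {f : MvPolynomial σ K} {m s : ℕ}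
    (h : HasAlgDetRepr f m s) :
    ∃ (R : Type u) (_ : CommRing R) (_ : Algebra K R) (_ : Module.Finite K R),
      Module.finrank K R ≤ s ∧ ∃ (l : R →ₗ[K] K) (A : Matrix (Fin m) (Fin m) (MvPolynomial σ R)),
        (∀ i j, (A i j).totalDegree ≤ 1) ∧
          (∀ d : σ →₀ ℕ, l (MvPolynomial.coeff d A.det) = MvPolynomial.coeff d f) ∧
            ∀ r : R, (∀ x, l (x * r) = 0) → r = 0 := by
  obtain ⟨R, _, _, _, hR, l, A, hA, hf⟩ := h
  let I : Ideal R := functionalKerIdeal l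
  let l' : (R ⧸ I) →ₗ[K] K :=
    ((I.restrictScalars K).liftQ l (functionalKerIdeal_le_ker l)).comp
      (Submodule.Quotient.restrictScalarsEquiv K I).symm.toLinearMap
  have hl' : ∀ r : R, l' (Ideal.Quotient.mk I r) = l r := fun r => rfl
  obtain ⟨A', hA', hdet'⟩ := HasDetRepr.map_holds (f := A.det) ⟨A, hA, rfl⟩ (Ideal.Quotient.mk I)
  refine ⟨R ⧸ I, inferInstance, inferInstance, inferInstance, ?_, l', A', hA', fun d => ?_, ?_⟩
  · exact (LinearMap.finrank_le_finrank_of_surjective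
      (f := (Ideal.Quotient.mkₐ K I).toLinearMap) (Ideal.Quotient.mkₐ_surjective K I)).trans hR
  · rw [hdet', coeff_map, hl', hf]
  · intro r hr
    obtain ⟨r, rfl⟩ := Ideal.Quotient.mk_surjective r
    refine Ideal.Quotient.eq_zero_iff_mem.mpr fun x => ?_
    rw [← hl', map_mul]
    exact hr _

end Field

end Literature.Computability.AlgebraicComplexity
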